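import Literature.AlgebraicGeometry.Motives.ProjectiveSpaceFieldPointsBijective
import Literature.AlgebraicGeometry.Motives.SmoothHypersurfaceScheme
import HarnessLib

/-!
# Field-valued points of closed subschemes and of the hypersurface `V₊(F)`

* **Reduced sources lift along closed immersions** (`exists_lift_of_range_subset`): if `ι : Z → X`
  is a closed immersion, `T` is reduced and `g : T → X` has `range g ⊆ range ι`, then `g` factors
  uniquely through `ι` — the base change `T ×_X Z → T` is a surjective closed immersion into a
  reduced scheme, hence an isomorphism (Mathlib `isIso_of_isClosedImmersion_of_surjective`). This is
  the universal property of the reduced induced structure, Hartshorne II Ex. 3.11(d) / Stacks 0356,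
  in the form needed for field-valued points (`T = Spec L`).
* For `k`-schemes: `AlgPoints.liftClosed` and the bijection
  `AlgPoints.equivSubtypeOfIsClosedImmersion : Z(L) ≃ {P ∈ X(L) | P ∈ range ι}` for a closed
  `k`-immersion `ι : Z → X` (Hartshorne II Ex. 2.7, 3.11).
* For the reduced hypersurface `X_F = V₊(F) ⊂ ℙⁿ⁺¹_k` of `Motives/SmoothHypersurfaceScheme`
  (`F` homogeneous of positive degree): `SmoothHypersurface.pointOfVec z hz hF`, the `L`-point with
  homogeneous coordinates `z ≠ 0`, `F(z) = 0`; every `L`-point is of this form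
  (`exists_eq_pointOfVec`) and the coordinates are unique up to `Lˣ` (`pointOfVec_eq_pointOfVec_iff`):
  `X_F(L) = {z ∈ Lⁿ⁺² ∖ 0 | F(z) = 0}/Lˣ` (Hartshorne II Ex. 2.14 with I Ex. 2.10).
* Galois: `σ • pointOfVec z = pointOfVec (σ ∘ z)` for `σ ∈ Aut(L/k)` (`smul_pointOfVec`), the
  coordinatewise action (Hartshorne II Ex. 4.7).

## References

* R. Hartshorne, *Algebraic Geometry*, GTM 52 (1977): II Ex. 2.7, 2.14, 3.11, 4.7. [Hartshorne1977]
* The Stacks project, Tag 0356 (reduced induced scheme structure, universal property).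
  [StacksProject]
-/

noncomputable section

open CategoryTheory CategoryTheory.Limits AlgebraicGeometry HomogeneousLocalization MvPolynomial

universe u

namespace Literature.AlgebraicGeometry.Motives

/-! ### Reduced sources lift along closed immersions -/

section Lift

variable {T X Z : Scheme.{u}} (ι : Z ⟶ X) (g : T ⟶ X)

/-- For `ι : Z → X` and `g : T → X` with `range g ⊆ range ι`, the base change `T ×_X Z → T` is
surjective. [folklore] -/
theorem surjective_pullback_fst_of_range_subset (h : Set.range g ⊆ Set.range ι) :
    Surjective (pullback.fst g ι) := by
  refine ⟨fun t => ?_⟩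
  have ht : t ∈ Set.range (pullback.fst g ι) := by
    rw [Scheme.Pullback.range_fst]
    exact h ⟨t, rfl⟩
  exact ht

/-- **Universal property of the reduced induced structure, point form**: a morphism from a reduced
scheme into `X` whose image lies in a closed subscheme `Z` factors through `Z` (the base change
`T ×_X Z → T` is a surjective closed immersion into a reduced scheme, hence an isomorphism, Mathlib
`isIso_of_isClosedImmersion_of_surjective`). Hartshorne II Ex. 3.11(d); Stacks 0356.
[cite: StacksProject, Tag 0356] -/
theorem isIso_pullback_fst_of_range_subset [IsClosedImmersion ι] [IsReduced T]
    (h : Set.range g ⊆ Set.range ι) : IsIso (pullback.fst g ι) :=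
  haveI := surjective_pullback_fst_of_range_subset ι g h
  isIso_of_isClosedImmersion_of_surjective _

/-- The factorisation `T → Z` of `g : T → X` through the closed immersion `ι` (for `T` reduced and
`range g ⊆ range ι`): inverse of `T ×_X Z ≅ T` followed by the projection to `Z`.
[cite: StacksProject, Tag 0356] -/
def liftOfRangeSubset [IsClosedImmersion ι] [IsReduced T] (h : Set.range g ⊆ Set.range ι) :
    T ⟶ Z :=
  haveI := isIso_pullback_fst_of_range_subset ι g h
  inv (pullback.fst g ι) ≫ pullback.snd g ι

/-- `liftOfRangeSubset ι g h ≫ ι = g`. [cite: StacksProject, Tag 0356] -/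
@[reassoc (attr := simp)]
theorem liftOfRangeSubset_comp [IsClosedImmersion ι] [IsReduced T] (h : Set.range g ⊆ Set.range ι) :
    liftOfRangeSubset ι g h ≫ ι = g := by
  haveI := isIso_pullback_fst_of_range_subset ι g h
  rw [liftOfRangeSubset, Category.assoc, ← pullback.condition, IsIso.inv_hom_id_assoc]

/-- The factorisation through a closed immersion is unique (closed immersions are monomorphisms).
[folklore] -/
theorem eq_liftOfRangeSubset [IsClosedImmersion ι] [IsReduced T] (h : Set.range g ⊆ Set.range ι)
    (l : T ⟶ Z) (hl : l ≫ ι = g) : l = liftOfRangeSubset ι g h := by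
  rw [← cancel_mono ι, hl, liftOfRangeSubset_comp]

/-- Existence and uniqueness of the factorisation. [cite: StacksProject, Tag 0356] -/
theorem existsUnique_lift_of_range_subset [IsClosedImmersion ι] [IsReduced T]
    (h : Set.range g ⊆ Set.range ι) : ∃! l : T ⟶ Z, l ≫ ι = g :=
  ⟨liftOfRangeSubset ι g h, liftOfRangeSubset_comp ι g h, eq_liftOfRangeSubset ι g h⟩

end Lift

/-! ### `L`-points of a closed subscheme of a `k`-scheme -/

namespace AlgPoints

variable {k : Type u} [Field k] {X Z : SchemeOver k} (ι : Z ⟶ X) {L : Type u} [Field L] [Algebra k L]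

/-- `Spec L` is reduced (instance for the `k`-scheme `specOver k L`, whose underlying scheme is
`Spec L` only up to unfolding `Over.mk`). [folklore] -/
instance isReduced_specOver_left : IsReduced (specOver k L).left :=
  inferInstanceAs (IsReduced (Spec (CommRingCat.of L)))

/-- The morphism underlying an `L`-point maps into any set containing its underlying point (`Spec L`
has a single point). [folklore] -/
theorem range_left_subset (P : AlgPoints X L) {S : Set X.left} (hP : P.pt ∈ S) :
    Set.range P.left ⊆ S := by
  rintro _ ⟨x, rfl⟩
  have hx : x = IsLocalRing.closedPoint L := Subsingleton.elim (α := PrimeSpectrum L) _ _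
  subst hx
  exact hP

/-- **An `L`-point of `X` lying on the closed subscheme `Z` lifts to an `L`-point of `Z`** (`Spec L`
is reduced). Hartshorne II Ex. 2.7 with Ex. 3.11(d). [folklore] -/
def liftClosed [IsClosedImmersion ι.left] (P : AlgPoints X L) (hP : P.pt ∈ Set.range ι.left) :
    AlgPoints Z L :=
  AlgPoints.mk (liftOfRangeSubset ι.left P.left (P.range_left_subset hP))
    (by rw [← Over.w ι, liftOfRangeSubset_comp_assoc]; exact Over.w P)

/-- The lift maps back to `P`. [folklore] -/
@[simp]
theorem map_liftClosed [IsClosedImmersion ι.left] (P : AlgPoints X L)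
    (hP : P.pt ∈ Set.range ι.left) : map ι (P.liftClosed ι hP) = P := by
  ext : 1
  exact liftOfRangeSubset_comp ι.left P.left (P.range_left_subset hP)

/-- `map ι` is injective for `ι` a monomorphism on underlying schemes (e.g. a closed immersion).
[folklore] -/
theorem map_injective_of_mono [Mono ι.left] : Function.Injective (map (L := L) ι) := by
  intro Q Q' h
  ext : 1
  rw [← cancel_mono ι.left]
  exact congrArg (fun P : AlgPoints X L => P.left) h

/-- The underlying point of an `L`-point of `Z` pushed to `X` lies in the range. [folklore] -/
theorem pt_map_mem_range (Q : AlgPoints Z L) : (map ι Q).pt ∈ Set.range ι.left :=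
  ⟨Q.pt, rfl⟩

/-- Lifting the image of an `L`-point of `Z` gives it back. [folklore] -/
@[simp]
theorem liftClosed_map [IsClosedImmersion ι.left] (Q : AlgPoints Z L) :
    (map ι Q).liftClosed ι (pt_map_mem_range ι Q) = Q :=
  map_injective_of_mono ι (map_liftClosed ι _ _)

/-- **`Z(L) = {P ∈ X(L) | P lies on Z}`** for a closed `k`-immersion `ι : Z → X`.
Hartshorne II Ex. 2.7, 3.11. [folklore] -/
def equivSubtypeOfIsClosedImmersion [IsClosedImmersion ι.left] :
    AlgPoints Z L ≃ {P : AlgPoints X L // P.pt ∈ Set.range ι.left} where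
  toFun Q := ⟨map ι Q, pt_map_mem_range ι Q⟩
  invFun P := P.1.liftClosed ι P.2
  left_inv Q := liftClosed_map ι Q
  right_inv P := Subtype.ext (map_liftClosed ι P.1 P.2)

end AlgPoints

/-! ### `L`-points of the hypersurface `V₊(F)` -/

namespace SmoothHypersurface

variable {k : Type u} [Field k] {n : ℕ} {L : Type u} [Field L] [Algebra k L]
variable (F : MvPolynomial (Fin (n + 2)) k) {d : ℕ}

attribute [local instance] MvPolynomial.gradedAlgebra

/-- An `L`-point of `ℙⁿ⁺¹_k` with homogeneous coordinates `z` lies on `V₊(F)` iff `F(z) = 0`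
(`F` homogeneous of positive degree). [folklore] -/
theorem pt_pointOfVec_mem_range_hypersurfaceι_iff (hF : F.IsHomogeneous d) (hd : 0 < d)
    (z : Fin (n + 2) → L) (hz : z ≠ 0) :
    (ProjectiveSpace.pointOfVec k z hz).pt ∈ Set.range (hypersurfaceι F).left ↔ aeval z F = 0 := by
  rw [range_hypersurfaceι]
  exact ProjectiveSpace.pt_pointOfVec_mem_zeroLocus_iff z hz hd
    ((mem_homogeneousSubmodule d F).mpr hF)

/-- **The `L`-point of `X_F = V₊(F)` with homogeneous coordinates `z`** (`z ≠ 0`, `F(z) = 0`; `F`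
homogeneous of positive degree): the point `[z]` of `ℙⁿ⁺¹_k` lifted to the reduced closed subscheme
`V₊(F)`. Hartshorne II Ex. 2.14, 3.11. [folklore] -/
def pointOfVec (hF : F.IsHomogeneous d) (hd : 0 < d) (z : Fin (n + 2) → L) (hz : z ≠ 0)
    (hFz : aeval z F = 0) : AlgPoints (hypersurface F) L :=
  (ProjectiveSpace.pointOfVec k z hz).liftClosed (hypersurfaceι F)
    ((pt_pointOfVec_mem_range_hypersurfaceι_iff F hF hd z hz).mpr hFz)

/-- `pointOfVec` pushed into `ℙⁿ⁺¹_k` is the point with homogeneous coordinates `z`. [folklore] -/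
@[simp]
theorem map_hypersurfaceι_pointOfVec (hF : F.IsHomogeneous d) (hd : 0 < d) (z : Fin (n + 2) → L)
    (hz : z ≠ 0) (hFz : aeval z F = 0) :
    AlgPoints.map (hypersurfaceι F) (pointOfVec F hF hd z hz hFz) =
      ProjectiveSpace.pointOfVec k z hz :=
  AlgPoints.map_liftClosed _ _ _

/-- **Every `L`-point of `X_F` has homogeneous coordinates** `z ≠ 0` with `F(z) = 0`. [folklore] -/
theorem exists_eq_pointOfVec (hF : F.IsHomogeneous d) (hd : 0 < d) (Q : AlgPoints (hypersurface F) L) :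
    ∃ (z : Fin (n + 2) → L) (hz : z ≠ 0) (hFz : aeval z F = 0), Q = pointOfVec F hF hd z hz hFz := by
  obtain ⟨z, hz, hP⟩ := ProjectiveSpace.exists_eq_pointOfVec (AlgPoints.map (hypersurfaceι F) Q)
  have hFz : aeval z F = 0 := by
    rw [← pt_pointOfVec_mem_range_hypersurfaceι_iff F hF hd z hz, ← hP]
    exact AlgPoints.pt_map_mem_range _ Q
  refine ⟨z, hz, hFz, AlgPoints.map_injective_of_mono (hypersurfaceι F) ?_⟩
  rw [hP, map_hypersurfaceι_pointOfVec]

/-- **Homogeneous coordinates on `X_F` are unique up to `Lˣ`.** [folklore] -/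
theorem pointOfVec_eq_pointOfVec_iff (hF : F.IsHomogeneous d) (hd : 0 < d) (z z' : Fin (n + 2) → L)
    (hz : z ≠ 0) (hz' : z' ≠ 0) (hFz : aeval z F = 0) (hFz' : aeval z' F = 0) :
    pointOfVec F hF hd z hz hFz = pointOfVec F hF hd z' hz' hFz' ↔ ∃ c : L, c ≠ 0 ∧ z' = c • z := by
  rw [← ProjectiveSpace.pointOfVec_eq_pointOfVec_iff (k := k) z z' hz hz',
    ← map_hypersurfaceι_pointOfVec F hF hd z hz hFz, ← map_hypersurfaceι_pointOfVec F hF hd z' hz' hFz']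
  exact (AlgPoints.map_injective_of_mono (hypersurfaceι F)).eq_iff.symm

/-- Scaling invariance: `pointOfVec (c • z) = pointOfVec z` for `c ≠ 0`. [folklore] -/
theorem pointOfVec_smul (hF : F.IsHomogeneous d) (hd : 0 < d) (z : Fin (n + 2) → L) (hz : z ≠ 0)
    (hFz : aeval z F = 0) (c : L) (hc : c ≠ 0) (hcz : c • z ≠ 0) (hFcz : aeval (c • z) F = 0) :
    pointOfVec F hF hd (c • z) hcz hFcz = pointOfVec F hF hd z hz hFz :=
  ((pointOfVec_eq_pointOfVec_iff F hF hd z (c • z) hz hcz hFz hFcz).mpr ⟨c, hc, rfl⟩).symm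

end SmoothHypersurface

/-! ### Galois action on homogeneous coordinates -/

namespace ProjectiveSpace

variable {k : Type u} [Field k] {n : ℕ} {L : Type u} [Field L] [Algebra k L]

attribute [local instance] MvPolynomial.gradedAlgebra ProjBaseChange.algebraBase

/-- A `k`-algebra automorphism `σ` of `L` transforms values of polynomials coordinatewise:
`σ (g(z)) = g(σ ∘ z)`. [folklore] -/
theorem algEquiv_aeval (σ : L ≃ₐ[k] L) (z : Fin (n + 1) → L) (g : MvPolynomial (Fin (n + 1)) k) :
    σ (aeval z g) = aeval (fun j => σ (z j)) g := by
  have h := DFunLike.congr_fun (MvPolynomial.comp_aeval (f := z) (σ : L →ₐ[k] L)) g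
  simpa using h

/-- `σ ∘ awayEval z = awayEval (σ ∘ z)` on `k[x]_{(t)}`. [folklore] -/
theorem algEquiv_comp_awayEval (σ : L ≃ₐ[k] L) {t : MvPolynomial (Fin (n + 1)) k} {d : ℕ}
    (ht : t ∈ MvPolynomial.homogeneousSubmodule (Fin (n + 1)) k d) (z : Fin (n + 1) → L)
    (hz : aeval z t ≠ 0) (hσz : aeval (fun j => σ (z j)) t ≠ 0) :
    (σ : L →+* L).comp (awayEval z hz).toRingHom = (awayEval (fun j => σ (z j)) hσz).toRingHom := by
  refine RingHom.ext fun q => ?_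
  obtain ⟨m, g, hg, rfl⟩ := Away.mk_surjective _ ht q
  change σ (awayEval z hz (Away.mk _ ht m g hg)) = awayEval _ hσz (Away.mk _ ht m g hg)
  rw [awayEval_mk _ _ ht, awayEval_mk _ _ ht, map_div₀, map_pow, algEquiv_aeval, algEquiv_aeval]

/-- **Galois acts on homogeneous coordinates coordinatewise** (chart form): for `σ ∈ Aut(L/k)`,
`σ • chartPoint z = chartPoint (σ ∘ z)` (the action `σ • P = Spec σ ≫ P` of `Motives/AlgPoints`).
Hartshorne II Ex. 4.7. [folklore] -/
theorem smul_chartPoint (σ : L ≃ₐ[k] L) {t : MvPolynomial (Fin (n + 1)) k} {d : ℕ}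
    (ht : t ∈ MvPolynomial.homogeneousSubmodule (Fin (n + 1)) k d) (hd : 0 < d)
    (z : Fin (n + 1) → L) (hz : aeval z t ≠ 0) (hσz : aeval (fun j => σ (z j)) t ≠ 0) :
    σ • chartPoint ht hd z hz = chartPoint ht hd (fun j => σ (z j)) hσz := by
  ext : 1
  change Spec.map (CommRingCat.ofHom (σ : L →+* L)) ≫
      (Spec.map (CommRingCat.ofHom (awayEval z hz).toRingHom) ≫
        Proj.awayι (MvPolynomial.homogeneousSubmodule (Fin (n + 1)) k) t ht hd) =
    Spec.map (CommRingCat.ofHom (awayEval _ hσz).toRingHom) ≫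
      Proj.awayι (MvPolynomial.homogeneousSubmodule (Fin (n + 1)) k) t ht hd
  rw [← Spec.map_comp_assoc, ← CommRingCat.ofHom_comp, algEquiv_comp_awayEval σ ht z hz hσz]

/-- `σ ∘ z ≠ 0` for `z ≠ 0`. [folklore] -/
theorem algEquiv_comp_ne_zero (σ : L ≃ₐ[k] L) {z : Fin (n + 1) → L} (hz : z ≠ 0) :
    (fun j => σ (z j)) ≠ 0 := by
  obtain ⟨i, hi⟩ := Function.ne_iff.mp hz
  exact Function.ne_iff.mpr ⟨i, by simpa using hi⟩

/-- **Galois acts on homogeneous coordinates coordinatewise**: `σ • [z] = [σ ∘ z]` for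
`σ ∈ Aut(L/k)`. Hartshorne II Ex. 4.7. [folklore] -/
theorem smul_pointOfVec (σ : L ≃ₐ[k] L) (z : Fin (n + 1) → L) (hz : z ≠ 0) :
    σ • pointOfVec k z hz = pointOfVec k (fun j => σ (z j)) (algEquiv_comp_ne_zero σ hz) := by
  have hi := apply_firstNe_ne_zero z hz
  have hσi : aeval (fun j => σ (z j)) (X (firstNe z hz) : MvPolynomial (Fin (n + 1)) k) ≠ 0 := by
    simpa using hi
  rw [pointOfVec_eq_chartPoint (fun j => σ (z j)) _ (X_mem (firstNe z hz)) one_pos hσi]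
  exact smul_chartPoint σ _ _ z _ hσi

end ProjectiveSpace

namespace SmoothHypersurface

variable {k : Type u} [Field k] {n : ℕ} {L : Type u} [Field L] [Algebra k L]
variable (F : MvPolynomial (Fin (n + 2)) k) {d : ℕ}

/-- **Galois acts on the homogeneous coordinates of points of `X_F` coordinatewise.**
Hartshorne II Ex. 4.7. [folklore] -/
theorem smul_pointOfVec (σ : L ≃ₐ[k] L) (hF : F.IsHomogeneous d) (hd : 0 < d) (z : Fin (n + 2) → L)
    (hz : z ≠ 0) (hFz : aeval z F = 0)
    (hFσz : aeval (fun j => σ (z j)) F = 0) :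
    σ • pointOfVec F hF hd z hz hFz =
      pointOfVec F hF hd (fun j => σ (z j)) (ProjectiveSpace.algEquiv_comp_ne_zero σ hz) hFσz := by
  refine AlgPoints.map_injective_of_mono (hypersurfaceι F) ?_
  rw [AlgPoints.map_smul, map_hypersurfaceι_pointOfVec, map_hypersurfaceι_pointOfVec,
    ProjectiveSpace.smul_pointOfVec]

/-- The equation `F = 0` is preserved by the coordinatewise Galois action. [folklore] -/
theorem aeval_algEquiv_comp_eq_zero (σ : L ≃ₐ[k] L) {z : Fin (n + 2) → L} (hFz : aeval z F = 0) :
    aeval (fun j => σ (z j)) F = 0 := by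
  rw [← ProjectiveSpace.algEquiv_aeval, hFz, map_zero]

end SmoothHypersurface

end Literature.AlgebraicGeometry.Motives
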